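import Literature.NumberTheory.Sieve.HeathBrownCubicTypeII
import Literature.NumberTheory.Sieve.HeathBrownCubicUpperBoundWeights
import HarnessLib

/-!
# The approximations of Lemma 3.7, hat side: the count behind `Û`, Buchstab ranges, weights, matching

Pure-proof tools (no definitions) for the deduction of **Lemma 3.7 from the corrected Lemma 7.1** in
D. R. Heath-Brown, *Primes represented by `x³ + 2y³`*, Acta Math. 186 (2001), 1–84, §7 pp. 42–47
(decomposition of **parity.S18**, `Literature.NumberTheory.Sieve.setOf_prime_cube_add_two_mul_cube_infinite`),
on the objects of `HeathBrownCubicTypeII` (`bilin`, `dWeight`, `cCoef`, `Jprimes`, the approximations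
`Û`) and `HeathBrownCubicSieveDecomposition` (`famSifted`, `famSiftedAbove`, the exact pieces).
Lemma 3.7 compares an exact piece — a sum of sifting functions `S_K^≺(𝒵_{P_1⋯P_{n+1}}, P_{n+1})`
over chains of prime ideals — with its approximation `Û`, a bilinear sum (3.3) with the weight
`d_S(𝐦)` supported on products of first-degree primes in boxes `∏ 𝒥(m_i)`. This file supplies the
generic (family-independent) half of that comparison:

* `bilin_dWeight_eq_sum_tuples` — the bilinear sum with weight `d_S(𝐦)` is the sum over prime tuples
  `(P_i) ∈ ∏ 𝒥(m_i)` of `(∏ log N(P_i)/(m_iξ log X)) · G(∏ P_i)`, where the **hat-side count**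
  `G_c(S) = ∑_i ∑_{RS'=I_i, S'=S} c_R` (written out as this double sum throughout) counts the members
  `I_i = R·S` whose cofactor is admitted by `c`; for `c = cCoef z` and `z`-rough `S` it is
  `#{i : S ∣ I_i, I_i z-rough, N(I_i)/N(S) square-free}` (`hatCount_cCoef_eq`, cofactor unique by
  cancellation), whence `G ≤ S_K(𝒵_S, z)` and `S_K(𝒵_S, z) − G = #{… N(I_i)/N(S) not square-free}`
  (`hatCount_le_famSifted`, `famSifted_sub_hatCount_eq`: the square-free defect of p. 45).
* `famSifted_sub_famSiftedAbove_le` — **Buchstab's inequality** for the change of sifting level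
  (p. 44): `S_K(𝒵_S, z) − S_K^≺(𝒵_S, P₀) ≤ ∑_{Q prime, z ≤ N(Q) ≤ N(P₀), Q ≺ P₀} #{i : S ∣ I_i, Q ∣ I_i, I_i z-rough}`;
  `mul_dvd_of_not_dvd`, `isRough_mul_iff`, `famSifted_antitone`, `eq_top_of_isRough_of_absNorm_lt`.
* `wtFactor_mem`, `tupleWt_bounds`, `one_add_pow_sub_one_le` — the weight
  `1 ≤ ∏ log N(P_i)/(m_iξ log X) ≤ (1 + 1/μ)^k` (`m_i ≥ μ`), p. 44.
* `exists_mem_Jprimes`, `Jprimes_index_unique`, `strictAnti_absNorm_of_mem_piFinset`,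
  `tuple_eq_of_prod_eq` — every first-degree prime lies in exactly one `𝒥(m)`; tuples in boxes with
  strictly decreasing `𝐦` have strictly decreasing norms and are determined by their product
  ((3.5): "the ideals `S` are square-free", so `d_S` has at most one term).
* `abs_sub_le_of_matching` — the abstract matching step: given an injection of the hat indices into
  the exact ones and a common majorant `G₁` (`G ≤ G₁`, `F∘φ ≤ G₁`, weight `≥ 1`),
  `|exact − hat| ≤ (unmatched exact terms) + ∑ [(G₁ − F∘φ) + (G₁ − G) + (wt − 1)G₁]` — the four
  error sources of pp. 42–45 (edge/close chains, Buchstab range, square-free defect, weight).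

## References

* D. R. Heath-Brown, *Primes represented by `x³ + 2y³`*, Acta Math. 186 (2001), 1–84: §3 p. 15
  (`Û^{(𝐦,n)}`, `S_K^{(1)}`), (3.4)–(3.5), §7 pp. 42–45. [cite: HeathBrownActa2001, §7 pp. 42–45]
* G. Harman, *Prime-Detecting Sieves*, LMS Monographs 33, Princeton (2007), §13.2. [cite: Harman2007, §13.2]

## Mathlib / tree search

Mathlib: `Finset.sum_comm`, `Finset.sum_eq_single`, `mul_right_cancel₀` (ideals of a Dedekind domain
form a cancellative monoid with zero), `Finset.sum_boole`, `Finset.card_filter_add_card_filter_not`,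
`Finset.card_biUnion_le`, `Ideal.prime_of_isPrime`, `Prime.exists_mem_finset_dvd`,
`StrictAnti.range_inj`, `Nat.floor_le`/`Nat.lt_floor_add_one`, `Real.rpow_def_of_pos`. Tree:
`HeathBrownCubicTypeII` (`bilin`, `dWeight`, `cCoef`, `Jprimes`, `mem_Jprimes_iff`, `hbXi_pos`,
`divisorPairs`, `mem_divisorPairs_iff`), `HeathBrownCubicSieveDecomposition` (`famSifted`,
`famSiftedAbove`, `PrimeLT`, `PrimeLT.absNorm_le`), `HeathBrownCubicSieveSetup` (`IsRough`,
`idealsLE`, `isCoprime_of_not_dvd`), `HeathBrownCubicUpperBoundTools` (`famSiftedAbove_le_famSifted`).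
-/

noncomputable section

open Polynomial NumberField Finset Filter Topology Asymptotics
open scoped nonZeroDivisors

namespace Literature.NumberTheory.Sieve.CubicSieve

open LFunctions.CubeRootTwoField CubicPrimes

section HatCore

variable {ι : Type*} (E : Finset ι) (I : ι → Ideal (𝓞 K))

/-! ### The hat-side count `G` and the expansion of the bilinear sums over prime tuples -/

open scoped Classical in
/-- **Expansion of the bilinear sum with the weight `d_S(𝐦)` over prime tuples**:
`∑_R c_R ∑_{RS ∈ 𝒵} d_S = ∑_{(P_i), P_i ∈ 𝒥(m_i)} (∏ log N(P_i)/(m_iξ log X)) · G_c(∏ P_i)`, where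
**`G_c(S) = ∑_i ∑_{RS' = I_i, S' = S} c_R`** is the hat-side count: for `c = c_R ∈ {0,1}` the number
of members `I_i = R·S` whose cofactor `R` is admitted by `c` (for `Û^{(𝐦,n)}`: `R` is
`X^{m_{n+1}ξ}`-rough with square-free norm — "`S_K^{(1)}(𝒵_{P_1⋯P_{n+1}}, X^{m_{n+1}ξ})`", p. 15).
Throughout this file `G_c(S)` is written out as this double sum. [cite: HeathBrownActa2001, §3 (3.3)] -/
theorem bilin_dWeight_eq_sum_tuples (X τ : ℝ) (c : Ideal (𝓞 K) → ℝ) {k : ℕ} (m : Fin k → ℕ) :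
    bilin E I c (dWeight X τ m) =
      ∑ P ∈ Fintype.piFinset (fun i => Jprimes X τ (m i)),
        (∏ i, Real.log (Ideal.absNorm (P i)) / ((m i : ℝ) * hbXi τ * Real.log X)) *
          ∑ i ∈ E, ∑ RS ∈ divisorPairs (I i), if ∏ j, P j = RS.2 then c RS.1 else 0 := by
  classical
  simp only [bilin, dWeight]
  simp_rw [sum_filter, mul_sum, mul_ite, mul_zero]
  -- swap the sums: `∑ i ∑ RS ∑ P = ∑ P ∑ i ∑ RS`
  rw [sum_comm]
  refine sum_congr rfl fun i _ => ?_
  rw [sum_comm]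
  refine sum_congr rfl fun P _ => sum_congr rfl fun RS _ => ?_
  split_ifs <;> ring

open scoped Classical in
/-- `G_c ≥ 0` for `c ≥ 0`. [folklore] -/
theorem hatCount_nonneg {c : Ideal (𝓞 K) → ℝ} (hc : ∀ R, 0 ≤ c R) (S : Ideal (𝓞 K)) :
    0 ≤ ∑ i ∈ E, ∑ RS ∈ divisorPairs (I i), if S = RS.2 then c RS.1 else 0 := by
  classical
  refine sum_nonneg fun i _ => sum_nonneg fun RS _ => ?_
  split_ifs
  · exact hc _
  · exact le_rfl

/-- Roughness of a product: `R·S` is `z`-rough iff both factors are (prime ideals dividing a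
product divide a factor). [folklore] -/
theorem isRough_mul_iff {z : ℝ} {R S : Ideal (𝓞 K)} :
    IsRough z (R * S) ↔ IsRough z R ∧ IsRough z S := by
  constructor
  · intro h
    exact ⟨fun P hP hPR => h hP (hPR.mul_right S), fun P hP hPS => h hP (hPS.mul_left R)⟩
  · rintro ⟨hR, hS⟩ P hP hPRS
    rcases hP.mul_le.mp (Ideal.le_of_dvd hPRS) with h | h
    · exact hR hP (Ideal.dvd_iff_le.mpr h)
    · exact hS hP (Ideal.dvd_iff_le.mpr h)

open scoped Classical in
/-- **The hat-side count at one member.** For a `z`-rough `S` and a nonzero member `I_i`, the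
inner sum `∑_{RS' = I_i, S' = S} c_R` with `c = cCoef z` is `1` exactly when `S ∣ I_i`, `I_i` is
`z`-rough and the cofactor has square-free norm `N(I_i)/N(S)`, and `0` otherwise (the cofactor is
unique by cancellation). [cite: HeathBrownActa2001, §3 p. 15] -/
theorem sum_divisorPairs_ite_cCoef_eq {i : ι} (hI : I i ≠ ⊥) (z : ℝ) {S : Ideal (𝓞 K)}
    (hS : IsRough z S) :
    (∑ RS ∈ divisorPairs (I i), if S = RS.2 then cCoef z RS.1 else 0) =
      if S ∣ I i ∧ IsRough z (I i) ∧ Squarefree (Ideal.absNorm (I i) / Ideal.absNorm S)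
        then 1 else 0 := by
  classical
  by_cases hdvd : S ∣ I i
  · obtain ⟨R₀, hR₀⟩ := hdvd
    have hS0 : S ≠ ⊥ := by rintro rfl; exact hI (by rw [hR₀, Ideal.bot_mul])
    have hmem : (R₀, S) ∈ divisorPairs (I i) := by
      rw [mem_divisorPairs_iff hI]; rw [hR₀, mul_comm]
    rw [sum_eq_single (R₀, S)]
    · -- the value at the cofactor
      simp only [if_true]
      have hNS : 0 < Ideal.absNorm S :=
        Nat.pos_of_ne_zero fun h => hS0 (Ideal.absNorm_eq_zero_iff.mp h)
      have hquot : Ideal.absNorm (I i) / Ideal.absNorm S = Ideal.absNorm R₀ := by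
        rw [hR₀, map_mul, Nat.mul_div_cancel_left _ hNS]
      have hrough : IsRough z (I i) ↔ IsRough z R₀ := by
        rw [hR₀, mul_comm, isRough_mul_iff]
        exact ⟨fun h => h.1, fun h => ⟨h, hS⟩⟩
      unfold cCoef
      rw [hquot]
      by_cases h1 : IsRough z R₀ ∧ Squarefree (Ideal.absNorm R₀)
      · rw [if_pos h1, if_pos ⟨⟨R₀, hR₀⟩, hrough.mpr h1.1, h1.2⟩]
      · rw [if_neg h1, if_neg]
        rintro ⟨-, hr, hsq⟩
        exact h1 ⟨hrough.mp hr, hsq⟩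
    · intro RS hRS hne
      rw [mem_divisorPairs_iff hI] at hRS
      split_ifs with h
      · exfalso
        apply hne
        have h1 : RS.1 * S = R₀ * S := by
          calc RS.1 * S = RS.1 * RS.2 := by rw [← h]
            _ = I i := hRS
            _ = S * R₀ := hR₀
            _ = R₀ * S := mul_comm _ _
        have h2 : RS.1 = R₀ := mul_right_cancel₀ (show S ≠ 0 from hS0) h1
        exact Prod.ext h2 h.symm
      · rfl
    · intro h; exact absurd hmem h
  · have hn : ¬ (S ∣ I i ∧ IsRough z (I i) ∧
        Squarefree (Ideal.absNorm (I i) / Ideal.absNorm S)) := fun h => hdvd h.1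
    rw [if_neg hn]
    refine sum_eq_zero fun RS hRS => ?_
    rw [mem_divisorPairs_iff hI] at hRS
    split_ifs with h
    · exact absurd ⟨RS.1, by rw [h, ← hRS, mul_comm]⟩ hdvd
    · rfl

open scoped Classical in
/-- **`G(S)` as a count**: for `z`-rough `S` and a family of nonzero ideals,
`G_{cCoef z}(S) = #{i : S ∣ I_i, I_i z-rough, N(I_i)/N(S) square-free}`. [cite: HeathBrownActa2001, §3 p. 15] -/
theorem hatCount_cCoef_eq (h0 : ∀ i ∈ E, I i ≠ ⊥) (z : ℝ) {S : Ideal (𝓞 K)} (hS : IsRough z S) :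
    (∑ i ∈ E, ∑ RS ∈ divisorPairs (I i), if S = RS.2 then cCoef z RS.1 else 0) =
      #{i ∈ E | S ∣ I i ∧ IsRough z (I i) ∧ Squarefree (Ideal.absNorm (I i) / Ideal.absNorm S)} := by
  classical
  rw [sum_congr rfl fun i hi => sum_divisorPairs_ite_cCoef_eq I (h0 i hi) z hS]
  rw [sum_boole]

open scoped Classical in
/-- **`G ≤ G₁`** and **`G₁ − G` counts the members with non-square-free cofactor norm**:
`S_K(𝒵_S, z) − G(S) = #{i : S ∣ I_i, I_i z-rough, N(I_i)/N(S) not square-free}` (`S` `z`-rough).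
[cite: HeathBrownActa2001, §7 p. 45] -/
theorem famSifted_sub_hatCount_eq (h0 : ∀ i ∈ E, I i ≠ ⊥) (z : ℝ) {S : Ideal (𝓞 K)}
    (hS : IsRough z S) :
    (famSifted E I S z : ℝ) - (∑ i ∈ E, ∑ RS ∈ divisorPairs (I i), if S = RS.2 then cCoef z RS.1 else 0) =
      #{i ∈ E | S ∣ I i ∧ IsRough z (I i) ∧ ¬ Squarefree (Ideal.absNorm (I i) / Ideal.absNorm S)} := by
  classical
  rw [hatCount_cCoef_eq E I h0 z hS, famSifted]
  have h := card_filter_add_card_filter_not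
    (s := E.filter fun i => S ∣ I i ∧ IsRough z (I i))
    (fun i => Squarefree (Ideal.absNorm (I i) / Ideal.absNorm S))
  rw [filter_filter, filter_filter] at h
  have e1 : (E.filter fun i => (S ∣ I i ∧ IsRough z (I i)) ∧
      Squarefree (Ideal.absNorm (I i) / Ideal.absNorm S)) =
      E.filter fun i => S ∣ I i ∧ IsRough z (I i) ∧
        Squarefree (Ideal.absNorm (I i) / Ideal.absNorm S) := by
    refine filter_congr fun i _ => ?_; tauto
  have e2 : (E.filter fun i => (S ∣ I i ∧ IsRough z (I i)) ∧
      ¬ Squarefree (Ideal.absNorm (I i) / Ideal.absNorm S)) =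
      E.filter fun i => S ∣ I i ∧ IsRough z (I i) ∧
        ¬ Squarefree (Ideal.absNorm (I i) / Ideal.absNorm S) := by
    refine filter_congr fun i _ => ?_; tauto
  rw [e1, e2] at h
  have h' : ((#(E.filter fun i => S ∣ I i ∧ IsRough z (I i) ∧
      Squarefree (Ideal.absNorm (I i) / Ideal.absNorm S)) : ℕ) : ℝ) +
      #(E.filter fun i => S ∣ I i ∧ IsRough z (I i) ∧
        ¬ Squarefree (Ideal.absNorm (I i) / Ideal.absNorm S)) =
      #(E.filter fun i => S ∣ I i ∧ IsRough z (I i)) := by exact_mod_cast h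
  linarith

open scoped Classical in
/-- `G ≤ S_K(𝒵_S, z)` (`S` `z`-rough). [cite: HeathBrownActa2001, §7 p. 44] -/
theorem hatCount_le_famSifted (h0 : ∀ i ∈ E, I i ≠ ⊥) (z : ℝ) {S : Ideal (𝓞 K)}
    (hS : IsRough z S) :
    (∑ i ∈ E, ∑ RS ∈ divisorPairs (I i), if S = RS.2 then cCoef z RS.1 else 0) ≤ famSifted E I S z := by
  have h := famSifted_sub_hatCount_eq E I h0 z hS
  have : (0 : ℝ) ≤ #{i ∈ E | S ∣ I i ∧ IsRough z (I i) ∧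
      ¬ Squarefree (Ideal.absNorm (I i) / Ideal.absNorm S)} := Nat.cast_nonneg _
  linarith

/-! ### The Buchstab range: `S_K(𝒵_S, z) − S_K^≺(𝒵_S, P₀)` -/

open scoped Classical in
/-- **Buchstab's inequality for the change of sifting level** (p. 44: "According to Buchstab's
formula this introduces an error `∑_{X^{m_{n+1}ξ} ≤ N(P) < N(P_{n+1})} S_K(𝒜_{P_1⋯P_{n+1}P}, N(P))`"):
for `z ≤ N(P₀)`... in fact for any `z`,
`S_K(𝒵_S, z) − S_K^≺(𝒵_S, P₀) ≤ ∑_{Q prime, z ≤ N(Q) ≤ N(P₀), Q ≺ P₀} #{i : S ∣ I_i, Q ∣ I_i, I_i z-rough}`.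
[cite: HeathBrownActa2001, §7 p. 44] -/
theorem famSifted_sub_famSiftedAbove_le (h0 : ∀ i ∈ E, I i ≠ ⊥) (S P₀ : Ideal (𝓞 K)) (z : ℝ) :
    (famSifted E I S z : ℝ) - famSiftedAbove E I S P₀ ≤
      ∑ Q ∈ (idealsLE (Ideal.absNorm P₀)).filter
          (fun Q => Q.IsPrime ∧ Q ≠ ⊥ ∧ z ≤ (Ideal.absNorm Q : ℝ) ∧ PrimeLT Q P₀),
        (#{i ∈ E | S ∣ I i ∧ Q ∣ I i ∧ IsRough z (I i)} : ℝ) := by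
  classical
  set A := E.filter fun i => S ∣ I i ∧ IsRough z (I i) with hA
  set good := A.filter fun i => ∀ ⦃Q : Ideal (𝓞 K)⦄, Q.IsPrime → Q ∣ I i → ¬ PrimeLT Q P₀ with hgood
  set bad := A.filter fun i => ¬ ∀ ⦃Q : Ideal (𝓞 K)⦄, Q.IsPrime → Q ∣ I i → ¬ PrimeLT Q P₀ with hbad
  set T := (idealsLE (Ideal.absNorm P₀)).filter
    (fun Q => Q.IsPrime ∧ Q ≠ ⊥ ∧ z ≤ (Ideal.absNorm Q : ℝ) ∧ PrimeLT Q P₀) with hT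
  have hsplit : #A = #good + #bad := (card_filter_add_card_filter_not _).symm
  have hgood_le : #good ≤ famSiftedAbove E I S P₀ := by
    rw [famSiftedAbove]
    refine card_le_card fun i hi => ?_
    simp only [hgood, hA, mem_filter] at hi
    exact mem_filter.mpr ⟨hi.1.1, hi.1.2.1, hi.2⟩
  have hbad_le : #bad ≤ ∑ Q ∈ T, #{i ∈ E | S ∣ I i ∧ Q ∣ I i ∧ IsRough z (I i)} := by
    calc #bad ≤ #(T.biUnion fun Q => E.filter fun i => S ∣ I i ∧ Q ∣ I i ∧ IsRough z (I i)) := by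
          refine card_le_card fun i hi => ?_
          simp only [hbad, hA, mem_filter, not_forall, exists_prop, not_not] at hi
          obtain ⟨⟨hiE, hSi, hri⟩, Q, hQ, hQi, hlt⟩ := hi
          have hQ0 : Q ≠ ⊥ := by
            rintro rfl
            refine h0 i hiE ?_
            have h1 : (0 : Ideal (𝓞 K)) ∣ I i := by rwa [Ideal.zero_eq_bot]
            have h2 := zero_dvd_iff.mp h1
            rwa [Ideal.zero_eq_bot] at h2
          rw [mem_biUnion]
          refine ⟨Q, ?_, mem_filter.mpr ⟨hiE, hSi, hQi, hri⟩⟩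
          simp only [hT, mem_filter, mem_idealsLE]
          exact ⟨hlt.absNorm_le, hQ, hQ0, hri hQ hQi, hlt⟩
      _ ≤ ∑ Q ∈ T, #(E.filter fun i => S ∣ I i ∧ Q ∣ I i ∧ IsRough z (I i)) := card_biUnion_le
  have h1 : (famSifted E I S z : ℝ) = #A := by rw [famSifted]
  rw [h1]
  have h2 : ((#A : ℕ) : ℝ) = #good + #bad := by exact_mod_cast hsplit
  have h3 : ((#good : ℕ) : ℝ) ≤ famSiftedAbove E I S P₀ := by exact_mod_cast hgood_le
  have h4 : ((#bad : ℕ) : ℝ) ≤ ∑ Q ∈ T, (#{i ∈ E | S ∣ I i ∧ Q ∣ I i ∧ IsRough z (I i)} : ℝ) := by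
    exact_mod_cast hbad_le
  linarith

/-- If a prime `Q` does not divide `S` then `S ∣ J` and `Q ∣ J` give `Q·S ∣ J`. [folklore] -/
theorem mul_dvd_of_not_dvd {Q S J : Ideal (𝓞 K)} (hQ : Q.IsPrime) (hQ0 : Q ≠ ⊥) (hQS : ¬ Q ∣ S)
    (hSJ : S ∣ J) (hQJ : Q ∣ J) : Q * S ∣ J :=
  (isCoprime_of_not_dvd hQ hQ0 hQS).symm.mul_dvd hQJ hSJ

/-! ### The tuple weight: `1 ≤ ∏ log N(P_i)/(m_iξ log X) ≤ ∏ (1 + 1/m_i)` -/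

/-- One factor of the tuple weight lies in `[1, 1 + 1/m)` for `N(P) ∈ J(m)`, `m ≥ 1`, `X > 1`,
`ξ > 0` (p. 44: "`1 ≤ log N(P_i)/(m_i ξ log X) ≤ 1 + m_i^{-1}`"). [cite: HeathBrownActa2001, §7 p. 44] -/
theorem wtFactor_mem {X τ : ℝ} (hX : 1 < X) (hτ : 0 < τ) {m : ℕ} (hm : 1 ≤ m) {P : Ideal (𝓞 K)}
    (hP : P ∈ Jprimes X τ m) :
    1 ≤ Real.log (Ideal.absNorm P) / ((m : ℝ) * hbXi τ * Real.log X) ∧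
      Real.log (Ideal.absNorm P) / ((m : ℝ) * hbXi τ * Real.log X) ≤ 1 + 1 / m := by
  obtain ⟨-, -, hlo, hhi, -⟩ := (mem_Jprimes_iff X τ).mp hP
  have hξ := hbXi_pos hτ
  have hlX : 0 < Real.log X := Real.log_pos hX
  have hm0 : (0 : ℝ) < m := by exact_mod_cast hm
  have hden : 0 < (m : ℝ) * hbXi τ * Real.log X := by positivity
  have hX0 : 0 < X := by linarith
  have hNpos : (0 : ℝ) < (Ideal.absNorm P : ℕ) := lt_of_lt_of_le (Real.rpow_pos_of_pos hX0 _) hlo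
  have h1 : (m : ℝ) * hbXi τ * Real.log X ≤ Real.log (Ideal.absNorm P) := by
    have := Real.log_le_log (Real.rpow_pos_of_pos hX0 _) hlo
    rwa [Real.log_rpow hX0] at this
  have h2 : Real.log (Ideal.absNorm P) ≤ ((m : ℝ) + 1) * hbXi τ * Real.log X := by
    have := Real.log_le_log hNpos hhi.le
    rwa [Real.log_rpow hX0] at this
  constructor
  · rwa [le_div_iff₀ hden, one_mul]
  · rw [div_le_iff₀ hden]
    calc Real.log (Ideal.absNorm P) ≤ ((m : ℝ) + 1) * hbXi τ * Real.log X := h2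
      _ = (1 + 1 / m) * ((m : ℝ) * hbXi τ * Real.log X) := by field_simp

/-- **The tuple weight is `≥ 1` and `≤ (1 + 1/μ)^k`** when every `m_i ≥ μ ≥ 1` (p. 44: "Thus (2.6),
(3.4) and (3.9) yield `1 ≤ d_S ≤ 1 + O(ξτ^{-2})`"; here in the raw form, with `μ = τξ^{-1}` and
`k ≤ n₀ + 1` in the applications). [cite: HeathBrownActa2001, §7 p. 44] -/
theorem tupleWt_bounds {X τ : ℝ} (hX : 1 < X) (hτ : 0 < τ) {k : ℕ} {m : Fin k → ℕ} {μ : ℕ}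
    (hμ : 1 ≤ μ) (hm : ∀ i, μ ≤ m i) {P : Fin k → Ideal (𝓞 K)}
    (hP : P ∈ Fintype.piFinset fun i => Jprimes X τ (m i)) :
    1 ≤ ∏ i, Real.log (Ideal.absNorm (P i)) / ((m i : ℝ) * hbXi τ * Real.log X) ∧
      ∏ i, Real.log (Ideal.absNorm (P i)) / ((m i : ℝ) * hbXi τ * Real.log X) ≤ (1 + 1 / μ) ^ k := by
  have hf := fun i => wtFactor_mem hX hτ (hμ.trans (hm i)) (Fintype.mem_piFinset.mp hP i)
  constructor
  · calc (1 : ℝ) = ∏ _i : Fin k, (1 : ℝ) := by simp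
      _ ≤ _ := prod_le_prod (fun _ _ => zero_le_one) fun i _ => (hf i).1
  · calc ∏ i, Real.log (Ideal.absNorm (P i)) / ((m i : ℝ) * hbXi τ * Real.log X)
        ≤ ∏ _i : Fin k, (1 + 1 / (μ : ℝ)) := by
          refine prod_le_prod (fun i _ => zero_le_one.trans (hf i).1) fun i _ => ?_
          refine (hf i).2.trans ?_
          have hμ0 : (0 : ℝ) < μ := by exact_mod_cast hμ
          have : (μ : ℝ) ≤ m i := by exact_mod_cast hm i
          gcongr
      _ = (1 + 1 / μ) ^ k := by simp

/-- `(1 + x)^k − 1 ≤ k x (1 + x)^k`... in the convenient form `(1+x)^k ≤ 1 + k x (1 + x)^{k}` hmm; we use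
the standard `(1 + x)^k ≤ exp(kx)` and `exp(y) − 1 ≤ y e^y`; here is the elementary version
`(1 + x)^k − 1 ≤ k x (1+x)^{k-1} ≤ k x (1 + x)^k` for `x ≥ 0`. [folklore] -/
theorem one_add_pow_sub_one_le {x : ℝ} (hx : 0 ≤ x) (k : ℕ) :
    (1 + x) ^ k - 1 ≤ k * x * (1 + x) ^ k := by
  induction k with
  | zero => simp
  | succ k ih =>
    have h1 : (1 : ℝ) ≤ (1 + x) ^ k := one_le_pow₀ (by linarith)
    have h2 : (1 + x) ^ k ≤ (1 + x) ^ (k + 1) := pow_le_pow_right₀ (by linarith) (Nat.le_succ k)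
    calc (1 + x) ^ (k + 1) - 1 = ((1 + x) ^ k - 1) * (1 + x) + x := by ring
      _ ≤ (k * x * (1 + x) ^ k) * (1 + x) + x := by gcongr
      _ = k * x * (1 + x) ^ (k + 1) + x * 1 := by ring
      _ ≤ k * x * (1 + x) ^ (k + 1) + x * (1 + x) ^ (k + 1) := by gcongr; exact h1.trans h2
      _ = ((k : ℝ) + 1) * x * (1 + x) ^ (k + 1) := by ring
      _ = ((k + 1 : ℕ) : ℝ) * x * (1 + x) ^ (k + 1) := by push_cast; ring

/-! ### Sifting levels and rough ideals: two elementary facts -/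

/-- `S_K(𝒵_R, ·)` is antitone in the level. [folklore] -/
theorem famSifted_antitone {R : Ideal (𝓞 K)} {z z' : ℝ} (hz : z ≤ z') :
    famSifted E I R z' ≤ famSifted E I R z := by
  classical
  unfold famSifted
  exact card_le_card (monotone_filter_right _ fun i _ hi => ⟨hi.1, hi.2.mono hz⟩)

omit E I in
/-- A nonzero `z`-rough ideal of norm `< z` is the unit ideal (a proper ideal has a prime factor, of
norm at most its own). [folklore] -/
theorem eq_top_of_isRough_of_absNorm_lt {R : Ideal (𝓞 K)} (hR0 : R ≠ ⊥) {z : ℝ} (hR : IsRough z R)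
    (hlt : (Ideal.absNorm R : ℝ) < z) : R = ⊤ := by
  by_contra hR1
  obtain ⟨P, hPmax, hRP⟩ := Ideal.exists_le_maximal R hR1
  have hzP : z ≤ (Ideal.absNorm P : ℝ) := hR hPmax.isPrime (Ideal.dvd_iff_le.mpr hRP)
  have hPR : (Ideal.absNorm P : ℝ) ≤ Ideal.absNorm R := by
    have h := Ideal.absNorm_dvd_absNorm_of_le hRP
    have hR0' : Ideal.absNorm R ≠ 0 := fun h0 => hR0 (Ideal.absNorm_eq_zero_iff.mp h0)
    exact_mod_cast Nat.le_of_dvd (Nat.pos_of_ne_zero hR0') h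
  linarith

/-! ### The intervals `J(m)`: existence and uniqueness of the index -/

omit E I in
/-- Every first-degree prime ideal of norm `≥ 1` lies in some `𝒥(m)` (`X > 1`, `τ > 0`):
`m = ⌊log N(P)/(ξ log X)⌋`. [cite: HeathBrownActa2001, §3 (3.4)] -/
theorem exists_mem_Jprimes {X τ : ℝ} (hX : 1 < X) (hτ : 0 < τ) {P : Ideal (𝓞 K)} (hP : P.IsPrime)
    (hP0 : P ≠ ⊥) (hp : (Ideal.absNorm P).Prime) : ∃ m : ℕ, P ∈ Jprimes X τ m := by
  have hξ := hbXi_pos hτ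
  have hlX : 0 < Real.log X := Real.log_pos hX
  have hX0 : 0 < X := by linarith
  have hN1 : (1 : ℝ) ≤ (Ideal.absNorm P : ℕ) := by exact_mod_cast hp.one_lt.le
  have hN0 : (0 : ℝ) < (Ideal.absNorm P : ℕ) := by linarith
  set t : ℝ := Real.log (Ideal.absNorm P) / (hbXi τ * Real.log X) with ht
  have ht0 : 0 ≤ t := div_nonneg (Real.log_nonneg hN1) (by positivity)
  refine ⟨⌊t⌋₊, (mem_Jprimes_iff X τ).mpr ⟨hP, hP0, ?_, ?_, hp⟩⟩
  · have h1 : ((⌊t⌋₊ : ℕ) : ℝ) * hbXi τ ≤ t * hbXi τ :=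
      mul_le_mul_of_nonneg_right (Nat.floor_le ht0) hξ.le
    have h2 : X ^ (((⌊t⌋₊ : ℕ) : ℝ) * hbXi τ) ≤ X ^ (t * hbXi τ) :=
      Real.rpow_le_rpow_of_exponent_le hX.le h1
    refine h2.trans (le_of_eq ?_)
    rw [Real.rpow_def_of_pos hX0, ht]
    field_simp
    exact Real.exp_log hN0
  · have h1 : t * hbXi τ < (((⌊t⌋₊ : ℕ) : ℝ) + 1) * hbXi τ :=
      mul_lt_mul_of_pos_right (Nat.lt_floor_add_one t) hξ
    have h2 : X ^ (t * hbXi τ) < X ^ ((((⌊t⌋₊ : ℕ) : ℝ) + 1) * hbXi τ) :=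
      Real.rpow_lt_rpow_of_exponent_lt hX h1
    refine lt_of_le_of_lt (le_of_eq ?_) h2
    rw [Real.rpow_def_of_pos hX0, ht]
    field_simp
    exact (Real.exp_log hN0).symm

omit E I in
/-- The index `m` with `P ∈ 𝒥(m)` is unique (the intervals `J(m)` are disjoint; `X > 1`, `τ > 0`).
[cite: HeathBrownActa2001, §3 (3.4)] -/
theorem Jprimes_index_unique {X τ : ℝ} (hX : 1 < X) (hτ : 0 < τ) {P : Ideal (𝓞 K)} {a b : ℕ}
    (ha : P ∈ Jprimes X τ a) (hb : P ∈ Jprimes X τ b) : a = b := by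
  have hξ := hbXi_pos hτ
  obtain ⟨-, -, ha1, ha2, -⟩ := (mem_Jprimes_iff X τ).mp ha
  obtain ⟨-, -, hb1, hb2, -⟩ := (mem_Jprimes_iff X τ).mp hb
  by_contra hne
  rcases Nat.lt_or_gt_of_ne hne with h | h
  · have h1 : ((a : ℝ) + 1) * hbXi τ ≤ (b : ℝ) * hbXi τ := by
      refine mul_le_mul_of_nonneg_right ?_ hξ.le
      exact_mod_cast Nat.succ_le_of_lt h
    have := Real.rpow_le_rpow_of_exponent_le hX.le h1
    linarith
  · have h1 : ((b : ℝ) + 1) * hbXi τ ≤ (a : ℝ) * hbXi τ := by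
      refine mul_le_mul_of_nonneg_right ?_ hξ.le
      exact_mod_cast Nat.succ_le_of_lt h
    have := Real.rpow_le_rpow_of_exponent_le hX.le h1
    linarith

omit E I in
/-- Norms decrease strictly along a tuple `P_i ∈ 𝒥(m_i)` with `m` strictly decreasing (`X > 1`,
`τ > 0`): the intervals `J(m_i)` are disjoint and ordered ((3.5): "whence the intervals `J(m_i)` are
disjoint"). [cite: HeathBrownActa2001, §3 (3.5)] -/
theorem strictAnti_absNorm_of_mem_piFinset {X τ : ℝ} (hX : 1 < X) (hτ : 0 < τ) {k : ℕ}
    {m : Fin k → ℕ} (hm : StrictAnti m) {P : Fin k → Ideal (𝓞 K)}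
    (hP : P ∈ Fintype.piFinset fun i => Jprimes X τ (m i)) :
    StrictAnti fun i => Ideal.absNorm (P i) := by
  intro i j hij
  have hξ := hbXi_pos hτ
  have hmij : m j + 1 ≤ m i := Nat.succ_le_of_lt (hm hij)
  obtain ⟨-, -, hi1, -, -⟩ := (mem_Jprimes_iff X τ).mp (Fintype.mem_piFinset.mp hP i)
  obtain ⟨-, -, -, hj2, -⟩ := (mem_Jprimes_iff X τ).mp (Fintype.mem_piFinset.mp hP j)
  have h1 : ((m j : ℝ) + 1) * hbXi τ ≤ (m i : ℝ) * hbXi τ := by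
    refine mul_le_mul_of_nonneg_right ?_ hξ.le
    exact_mod_cast hmij
  have h2 := Real.rpow_le_rpow_of_exponent_le hX.le h1
  exact_mod_cast (hj2.trans_le (h2.trans hi1))

omit E I in
/-- **Unique factorisation for admissible tuples**: two tuples of prime ideals in boxes
`∏ 𝒥(m_i)`, `∏ 𝒥(m'_i)` with `m, m'` strictly decreasing and the same product coincide, and then
`m = m'` ("the ideals `S` are square-free", (3.5); so `d_S` has at most one term).
[cite: HeathBrownActa2001, §3 (3.5)] -/
theorem tuple_eq_of_prod_eq {X τ : ℝ} (hX : 1 < X) (hτ : 0 < τ) {k : ℕ} {m m' : Fin k → ℕ}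
    (hm : StrictAnti m) (hm' : StrictAnti m') {P P' : Fin k → Ideal (𝓞 K)}
    (hP : P ∈ Fintype.piFinset fun i => Jprimes X τ (m i))
    (hP' : P' ∈ Fintype.piFinset fun i => Jprimes X τ (m' i)) (h : ∏ i, P i = ∏ i, P' i) :
    P = P' ∧ m = m' := by
  have hJ := fun i => (mem_Jprimes_iff X τ).mp (Fintype.mem_piFinset.mp hP i)
  have hJ' := fun i => (mem_Jprimes_iff X τ).mp (Fintype.mem_piFinset.mp hP' i)
  -- each `P' j` is some `P i` and conversely
  have key : ∀ {Q Q' : Fin k → Ideal (𝓞 K)},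
      (∀ i, (Q i).IsPrime ∧ Q i ≠ ⊥) → (∀ j, (Q' j).IsPrime ∧ Q' j ≠ ⊥) →
      ∏ i, Q i = ∏ i, Q' i → ∀ j, ∃ i, Q' j = Q i := by
    intro Q Q' hQ hQ' hprod j
    have hpr : Prime (Q' j) := Ideal.prime_of_isPrime (hQ' j).2 (hQ' j).1
    have hdvd : Q' j ∣ ∏ i, Q i := by rw [hprod]; exact dvd_prod_of_mem _ (mem_univ j)
    obtain ⟨i, -, hi⟩ := hpr.exists_mem_finset_dvd hdvd
    refine ⟨i, ?_⟩
    exact (((hQ i).1.isMaximal (hQ i).2).eq_of_le (hQ' j).1.ne_top (Ideal.le_of_dvd hi)).symm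
  have hQ : ∀ i, (P i).IsPrime ∧ P i ≠ ⊥ := fun i => ⟨(hJ i).1, (hJ i).2.1⟩
  have hQ' : ∀ j, (P' j).IsPrime ∧ P' j ≠ ⊥ := fun j => ⟨(hJ' j).1, (hJ' j).2.1⟩
  have k1 := key hQ hQ' h
  have k2 := key hQ' hQ h.symm
  have hrange : Set.range (fun i => Ideal.absNorm (P i)) = Set.range (fun i => Ideal.absNorm (P' i)) := by
    ext n
    simp only [Set.mem_range]
    constructor
    · rintro ⟨i, rfl⟩
      obtain ⟨j, hj⟩ := k2 i
      exact ⟨j, by rw [hj]⟩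
    · rintro ⟨j, rfl⟩
      obtain ⟨i, hi⟩ := k1 j
      exact ⟨i, by rw [hi]⟩
  have hA := strictAnti_absNorm_of_mem_piFinset hX hτ hm hP
  have hA' := strictAnti_absNorm_of_mem_piFinset hX hτ hm' hP'
  have hNeq : (fun i => Ideal.absNorm (P i)) = fun i => Ideal.absNorm (P' i) :=
    (hA.range_inj hA').mp hrange
  have hPP' : P = P' := by
    funext i
    obtain ⟨j, hj⟩ := k1 i
    have h1 : Ideal.absNorm (P' i) = Ideal.absNorm (P i) := (congrFun hNeq i).symm
    rw [hj] at h1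
    have hji : j = i := hA.injective h1
    rw [hj, hji]
  refine ⟨hPP', funext fun i => ?_⟩
  have h1 : P i ∈ Jprimes X τ (m i) := Fintype.mem_piFinset.mp hP i
  have h2 : P i ∈ Jprimes X τ (m' i) := by rw [hPP']; exact Fintype.mem_piFinset.mp hP' i
  exact Jprimes_index_unique hX hτ h1 h2

/-! ### The abstract matching step: exact pieces versus their approximations -/

omit E I in
/-- **Matching.** Let an exact piece `∑_{a∈R} F(a)` (`F ≥ 0`) and its approximation
`∑_{b∈A} wt(b)·G(b)` be given together with an injection `φ : A → R` of the hat indices into the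
exact ones and a majorant `G₁` with `G ≤ G₁`, `F(φ b) ≤ G₁(b)`, `wt ≥ 1`. Then
`|∑_R F − ∑_A wt·G| ≤ ∑_{a ∈ R unmatched} F(a) + ∑_{b∈A} [(G₁ − F∘φ) + (G₁ − G) + (wt − 1)·G₁]`:
the unmatched exact terms, the Buchstab range, the square-free defect and the weight error of
pp. 42–45. [cite: HeathBrownActa2001, §7 pp. 42–45] -/
theorem abs_sub_le_of_matching {α β : Type*} [DecidableEq α] (R : Finset α) (A : Finset β)
    (F : α → ℝ) (G G₁ wt : β → ℝ) (φ : β → α)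
    (hφ : ∀ b ∈ A, φ b ∈ R) (hinj : Set.InjOn φ A)
    (hF0 : ∀ a ∈ R, 0 ≤ F a) (hG0 : ∀ b ∈ A, 0 ≤ G b) (hGG₁ : ∀ b ∈ A, G b ≤ G₁ b)
    (hFG₁ : ∀ b ∈ A, F (φ b) ≤ G₁ b) (hwt : ∀ b ∈ A, 1 ≤ wt b) :
    |∑ a ∈ R, F a - ∑ b ∈ A, wt b * G b| ≤
      ∑ a ∈ R.filter (fun a => a ∉ A.image φ), F a +
        ∑ b ∈ A, ((G₁ b - F (φ b)) + (G₁ b - G b) + (wt b - 1) * G₁ b) := by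
  classical
  have h1 : ∑ b ∈ A, F (φ b) ≤ ∑ a ∈ R, F a := by
    rw [← sum_image hinj]
    exact sum_le_sum_of_subset_of_nonneg (image_subset_iff.mpr hφ) fun a ha _ => hF0 a ha
  have h2 : ∑ a ∈ R, F a = ∑ a ∈ R.filter (fun a => a ∉ A.image φ), F a +
      ∑ a ∈ R.filter (fun a => a ∈ A.image φ), F a := by
    rw [add_comm, sum_filter_add_sum_filter_not]
  have h3 : ∑ a ∈ R.filter (fun a => a ∈ A.image φ), F a ≤ ∑ b ∈ A, F (φ b) := by
    calc ∑ a ∈ R.filter (fun a => a ∈ A.image φ), F a ≤ ∑ a ∈ A.image φ, F a := by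
          refine sum_le_sum_of_subset_of_nonneg (fun a ha => (mem_filter.mp ha).2) fun a ha _ => ?_
          obtain ⟨b, hb, rfl⟩ := mem_image.mp ha
          exact hF0 _ (hφ b hb)
      _ ≤ ∑ b ∈ A, F (φ b) := by
          refine sum_image_le_of_nonneg fun a ha => ?_
          obtain ⟨b, hb, rfl⟩ := mem_image.mp ha
          exact hF0 _ (hφ b hb)
  have hU0 : 0 ≤ ∑ a ∈ R.filter (fun a => a ∉ A.image φ), F a :=
    sum_nonneg fun a ha => hF0 a (mem_filter.mp ha).1
  rw [abs_sub_le_iff]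
  constructor
  · calc ∑ a ∈ R, F a - ∑ b ∈ A, wt b * G b
        ≤ (∑ a ∈ R.filter (fun a => a ∉ A.image φ), F a + ∑ b ∈ A, F (φ b)) -
            ∑ b ∈ A, wt b * G b := by linarith
      _ = ∑ a ∈ R.filter (fun a => a ∉ A.image φ), F a + ∑ b ∈ A, (F (φ b) - wt b * G b) := by
          rw [sum_sub_distrib]; ring
      _ ≤ ∑ a ∈ R.filter (fun a => a ∉ A.image φ), F a +
            ∑ b ∈ A, ((G₁ b - F (φ b)) + (G₁ b - G b) + (wt b - 1) * G₁ b) := by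
          gcongr with b hb
          have e1 := hFG₁ b hb; have e2 := hGG₁ b hb; have e3 := hwt b hb; have e4 := hG0 b hb
          nlinarith
  · calc ∑ b ∈ A, wt b * G b - ∑ a ∈ R, F a ≤ ∑ b ∈ A, wt b * G b - ∑ b ∈ A, F (φ b) := by
          linarith
      _ = ∑ b ∈ A, (wt b * G b - F (φ b)) := by rw [sum_sub_distrib]
      _ ≤ ∑ b ∈ A, ((G₁ b - F (φ b)) + (G₁ b - G b) + (wt b - 1) * G₁ b) := by
          gcongr with b hb
          have e2 := hGG₁ b hb; have e3 := hwt b hb; have e4 := hG0 b hb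
          nlinarith
      _ ≤ _ := by linarith

end HatCore

end Literature.NumberTheory.Sieve.CubicSieve

end
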